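import Summits.HodgeConjecture.HodgeConjecture.Theorems.NikulinTwinTransportTwinTwistorTransportReduction
import Summits.HodgeConjecture.HodgeConjecture.Theorems.NikulinTwinTransportTwinSimilitudeAlgebraicTransfer

/-!
# Route NikulinTwinTransport · crux `TwinTwistorTransport` (stmt-HodgeConjecture-14393) —
# the crux from the route TARGET, and the equivalence crux ⟺ target

The route's DAG closes the target X = `TwinSimilitudeAlgebraic` (stmt-HodgeConjecture-13674) from
the crux `TwinTwistorTransport` and Buskin's theorem (`HodgeIsometryAlgebraic`, item 13675) through
the composition of algebraic correspondences (`twinSimilitudeAlgebraic_of_anchor`, landed). This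
file records the CONVERSE arrow as a theorem of the tree, so far stated only in print ("X + twin ⇒
crux"): granted the three K3 facts (surjectivity of the period map in projective form, existence of
markings, Hodge types of `H²(K3)` — named, unproved Literature facts, exactly the hypotheses of the
landed `twinTwistorTransport_of_ratTwinTransport`), the target X implies the crux
(`twinTwistorTransport_of_twinSimilitudeAlgebraic`): X makes the twin similitude `η⁻¹ ∘ M ∘ η″` of
the rational `2`-similitude `M` of `Λ_{K3}` algebraic on every `M`-twin pair
(`twinTransport_of_twinSimilitudeAlgebraic`, landed), and one such twin transport gives the crux
(`twinTwistorTransport_of_ratTwinTransport`, landed). Hence, modulo Buskin, the composition of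
correspondences and the three K3 facts, the crux and the target are EQUIVALENT
(`twinTwistorTransport_iff_twinSimilitudeAlgebraic`): the typed crux carries exactly the research
content of X — an open sub-case of the Hodge conjecture in print (Varesco, Math. Z. 305 (2023),
Thm. 2.1 and Prop. 2.5: known on the Nikulin locus; van Geemen–Schütt 2023 Rem. 4.9: no inducing
cycle known on the maximal real-multiplication families). Nothing here proves the crux or X.
Prover seat prover-HodgeConjecture-route-HodgeConjecture-NikulinTwinTransport-2, 2026-08-16.
-/

noncomputable section

open CategoryTheory MonoidalCategory
open scoped Manifold
open Literature.AlgebraicGeometry.Motives Literature.AlgebraicGeometry.HodgeTheory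
open Literature.AlgebraicGeometry.Surfaces Literature.Geometry.Kaehler
open Literature.AlgebraicTopology.SingularHomology
open Summit.HodgeConjecture.HodgeConjecture.Theses.NikulinTwinTransport

namespace Summit.HodgeConjecture.HodgeConjecture.Theorems.NikulinTwinTransport

/-- `CompCorr`: composition of algebraic correspondences between smooth projective surfaces. Local
notation only, verbatim from `NikulinTwinTransportTwinTwistorTransportReduction`. -/
local notation3 (prettyPrint := false) "CompCorr" =>
  ∀ (μ : OrientationFamily), μ.HasPoincareDuality →
    ∀ (A B C : SchemeOver ℂ) (hA : IsSmoothProjective 2 A) (hB : IsSmoothProjective 2 B)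
      (hC : IsSmoothProjective 2 C),
      ∀ γ ∈ algebraicClasses (MonoidalCategoryStruct.tensorObj A B) 2,
        ∀ γ₁ ∈ algebraicClasses (MonoidalCategoryStruct.tensorObj B C) 2,
          ∃ γ₂ ∈ algebraicClasses (MonoidalCategoryStruct.tensorObj A C) 2,
            ∀ x : complexBetti C (2 * 1),
              complexGysin μ (IsSmoothProjective.tensor_holds hA hC) hA
                  (SemiCartesianMonoidalCategory.fst A C)
                  (rfl : 2 * 1 + 2 * 2 + 2 * 2 = 2 * 1 + 2 * (2 + 2))
                  (cupProduct (rfl : 2 * 1 + 2 * 2 = 2 * 1 + 2 * 2)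
                    (complexBetti.map (SemiCartesianMonoidalCategory.snd A C) (2 * 1) x) γ₂) =
                complexGysin μ (IsSmoothProjective.tensor_holds hA hB) hA
                  (SemiCartesianMonoidalCategory.fst A B)
                  (rfl : 2 * 1 + 2 * 2 + 2 * 2 = 2 * 1 + 2 * (2 + 2))
                  (cupProduct (rfl : 2 * 1 + 2 * 2 = 2 * 1 + 2 * 2)
                    (complexBetti.map (SemiCartesianMonoidalCategory.snd A B) (2 * 1)
                      (complexGysin μ (IsSmoothProjective.tensor_holds hB hC) hB
                        (SemiCartesianMonoidalCategory.fst B C)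
                        (rfl : 2 * 1 + 2 * 2 + 2 * 2 = 2 * 1 + 2 * (2 + 2))
                        (cupProduct (rfl : 2 * 1 + 2 * 2 = 2 * 1 + 2 * 2)
                          (complexBetti.map (SemiCartesianMonoidalCategory.snd B C) (2 * 1) x)
                          γ₁)))
                    γ)

/-- **The crux `TwinTwistorTransport` from the route target X.** Granted the three K3 facts —
surjectivity of the period map in projective form, existence of markings with projective period,
and the Hodge types of `H²(K3)` (named, unproved Literature facts) — the target
X = `TwinSimilitudeAlgebraic` ("every rational, type-preserving `2`-similitude
`H²(S′(ℂ); ℂ) → H²(S(ℂ); ℂ)` between projective K3 surfaces is `fst_*(snd^*(–) ∪ γ)` for an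
algebraic `γ`") implies the crux: X makes the twin similitude `η⁻¹ ∘ M ∘ η′` of every rational
`2`-similitude `M` of the K3 lattice algebraic on every `M`-twin pair of marked projective K3
surfaces (`twinTransport_of_twinSimilitudeAlgebraic`), and twin transport at multiplier `2` gives
the crux (`twinTwistorTransport_of_ratTwinTransport`: mark `S`, realise the twin period by a
projective `S″`, `Ψ = η⁻¹ ∘ M ∘ η″`). [cite: Varesco2023, §2 (proof of Thm. 2.1)] [cite: Buskin2019, §6.2] -/
theorem twinTwistorTransport_of_twinSimilitudeAlgebraic :
    Huybrechts_K3_periodSurjective_projective → Huybrechts_K3_marking_exists →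
    Huybrechts_K3_hodgeTypes_H2 → TwinSimilitudeAlgebraic → TwinTwistorTransport :=
  fun hP hMk hHT hX =>
    twinTwistorTransport_of_ratTwinTransport hP hMk hHT fun M _ hMrat _ _ _ hM2 =>
      twinTransport_of_twinSimilitudeAlgebraic hHT hX M hMrat hM2

/-- **Crux ⟺ target.** Modulo Buskin's theorem (`HodgeIsometryAlgebraic`, item
stmt-HodgeConjecture-13675), the composition of algebraic correspondences between smooth projective
surfaces and the three K3 facts, the crux `TwinTwistorTransport` (stmt-HodgeConjecture-14393) and
the route target `TwinSimilitudeAlgebraic` (stmt-HodgeConjecture-13674) are equivalent: `→` is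
`twinSimilitudeAlgebraic_of_anchor` (the crux is verbatim its anchor hypothesis (A)), `←` is
`twinTwistorTransport_of_twinSimilitudeAlgebraic`. So the typed crux is neither weaker nor stronger
than X in that world: both are the open sub-case "rational Hodge `2`-similitudes between projective
K3 surfaces are algebraic" (known on the Nikulin locus only).
[cite: Varesco2023, Thm. 2.1 and Prop. 2.5] [cite: Buskin2019, Thm. 1.1] -/
theorem twinTwistorTransport_iff_twinSimilitudeAlgebraic (hB : HodgeIsometryAlgebraic)
    (hC : CompCorr) (hP : Huybrechts_K3_periodSurjective_projective)
    (hMk : Huybrechts_K3_marking_exists) (hHT : Huybrechts_K3_hodgeTypes_H2) :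
    TwinTwistorTransport ↔ TwinSimilitudeAlgebraic :=
  ⟨twinSimilitudeAlgebraic_of_anchor hB hC,
    twinTwistorTransport_of_twinSimilitudeAlgebraic hP hMk hHT⟩

end Summit.HodgeConjecture.HodgeConjecture.Theorems.NikulinTwinTransport

end
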